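import Literature.AlgebraicGeometry.Motives.HodgeStructureLefschetzGroupInvariantsDegreewise
import HarnessLib

/-!
# Milne 1999, Lemma 3.1 + Thm. 3.2 WITH RATIONAL COEFFICIENTS: the `S(H)`-invariant RATIONAL exterior classes of a
# polarized `ℚ`-Hodge structure of odd weight are generated, over `ℚ`, by the rational divisor `2`-vectors

[topic AlgebraicGeometry/Motives]

Layer `Literature/AlgebraicGeometry/Motives`, lane `lit-hodgefound` (Track 2 foundations library; seat `lit-hodgefound-p34`,
generation 25, self-proposed row g25-#6 of `run/shared/lean/pub/lit-hodgefound/SKELETON.md`). THEOREMS ONLY (no definition,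
no named fact; net debt `0`). CARRIER: a pure `ℚ`-Hodge structure `H` of odd weight `n` on `V` with a polarization `Q`, the
exterior algebra `⋀_ℚ V ⊇ ⋀[ℚ]^k V` with RATIONAL coefficients, p02's extension of scalars
`toComplexAlg V : ⋀_ℚ V →ₐ[ℚ] ⋀_ℂ (ℂ ⊗ V)` (`x ↦ x ⊗ 1`, `Motives/HodgeStructureExteriorPowerHodgeRiemann`; on `⋀ᵏ` it is
the canonical base change `θ₀ (1 ⊗ x)`, `coe_exteriorPowerBaseChange_one_tmul`, `Motives.exteriorPowerBaseChangeEquiv`), and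
Milne's group through its `ℂ`-points `S(H)(ℂ) = Q.lefschetzGroupBaseChange ℂ` (g18-#1) acting by `⋀(γ) = ExteriorAlgebra.map γ`.
The seat's g25-#3/#5 (`…InvariantsDivisorClasses`, `…InvariantsDegreewise`) proved Thm. 3.2 with coefficients in an
algebraically closed `K ⊇ ℚ`; this file DESCENDS it to `ℚ`, which for the Betti theory (`k = ℚ`) is the statement as printed.

## The source, verbatim

J. S. Milne, *Lefschetz classes on abelian varieties*, Duke Math. J. **96** (1999) 639–675 [Milne1999LefschetzClasses] (held
`paper:doi-10-1215-s0012-7094-99-09620-5` p0014 L78–L91, p. 652; p0015 L12–L30, p. 653): "The set of vectors in `V` fixed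
by `G` is a subspace of `V`, which we denote `V^G`. When `G(k)` is Zariski dense in `G_{/k^{al}}` […] `V^G` is the space of
vectors in `V` fixed by the elements of `G(k)`. The next lemma shows that the formation of the space of fixed vectors commutes
with extension of scalars and with products. **Lemma 3.1.** Let `G` and `H` be algebraic groups over `k` acting on
finite-dimensional `k`-vector spaces `V` and `W` respectively. Then `(V^G) ⊗_k k^{al} = (V ⊗_k k^{al})^{G_{k^{al}}}` and
`(V ⊗_k W)^{G×H} = V^G ⊗_k W^H`. […] it suffices to prove the equality with `k` replaced with `k^{al}`, i.e., we may assume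
`k` to be algebraically closed." — "**Theorem 3.2.** For any abelian variety `A` over `Ω` and integer `r ≥ 0`, the
`k`-algebra `H*(A^r)^{S(A)}` is generated by divisor classes. […] **Proposition 3.3.** […] the `k`-vector space
`H²(A^r)^{S(A)}` is generated by divisor classes." Here `k = ℚ` (Betti cohomology, `H¹(A, ℚ) = V`, `H*(A, ℚ) = ⋀_ℚ V^∨ ≅ ⋀_ℚ V`
through `Q`), the algebraically closed overfield is `ℂ`, and "fixed by `S(A)`" for a rational class `x` means that
`x ⊗ 1 ∈ H*(A, ℂ)` is fixed by `S(A)(ℂ)` (p. 652 L78–L80). D. Mumford, *Abelian varieties* (1970) [MumfordAV1970] §21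
Application III p. 208: `NS(A) ⊗ ℚ ≅ {a ∈ End⁰(A) | a† = a}` (the divisor classes are the `Q(a ·, ·)`, `a` `†`-symmetric).

## What is PROVED (`Θ = toComplexAlg V`; `D_ℚ`, `D_ℂ` the rational / complex divisor `2`-vectors, below)

The RATIONAL DIVISOR `2`-VECTORS are `D_ℚ = {y ∈ ⋀[ℚ]^2 V | ∃ a ∈ E_φ, a† = a, ψ_y = Q(a ·, ·)}` where
`ψ_y(v, w) = B_y(Q(v, ·), Q(w, ·))` is the skew form of `y` read through `Q` (`ExteriorLefschetz.contractionForm`); the complex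
ones `D_ℂ ⊆ ⋀[ℂ]^2 (ℂ ⊗ V)` are those of g25-#3 (`ψ_{y'} = (Q(a ·, ·))_ℂ`).
* §1 `Θ` AND THE CONTRACTION FORM: **`contractionForm_toComplexAlg_one_tmul`** (`B_{Θ y}(B_ℂ(1 ⊗ v, ·), B'_ℂ(1 ⊗ w, ·)) =
  B_y(B(v, ·), B'(w, ·))` for `y ∈ ⋀²_ℚ V`), **`compl₁₂_contractionForm_toComplexAlg_baseChange`** (`ψ_{Θ y}` for `B_ℂ` is the
  base change of `ψ_y` for `B`).
* §2 LINEAR DISJOINTNESS OF `ℚ ⊂ ℂ` ON THE EXTERIOR ALGEBRA: `span_image_toComplexAlg_span` / `_mul` / **`_pow`**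
  (`span_ℂ Θ(M^p) = (span_ℂ Θ(M))^p` for a `ℚ`-submodule `M` of `⋀_ℚ V`), `mem_of_one_tmul_mem_span_image` (`1 ⊗ x ∈ ℂ · (1 ⊗ N)
  ⟹ x ∈ N`), **`mem_of_toComplexAlg_mem_span_image`** (`x ∈ ⋀ᵏ_ℚ V`, `N ≤ ⋀ᵏ_ℚ V`, `Θ x ∈ span_ℂ Θ(N) ⟹ x ∈ N` — Lemma 3.1's
  "`I^{Gal} ⊗ k^{al} = I`" for the lattice `⋀ᵏ_ℚ V ⊂ ⋀ᵏ_ℂ V_ℂ`), `coe_decompose_toComplexAlg` (`Θ` respects the grading).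
* §3 RATIONAL DIVISOR `2`-VECTORS: `Polarization.form_comp_isAlt_of_adjoint_eq` (`Q(a ·, ·)` is alternating for `a† = a`;
  `Q` itself is, p02's `Polarization.form_isAlt_of_odd`),
  **`Polarization.exists_mem_exteriorPower_two_rat_forall_contractionForm_apply_eq`** (for every `†`-symmetric `a` a unique
  `y_a ∈ ⋀[ℚ]^2 V` with `ψ_{y_a} = Q(a ·, ·)`),
  `Polarization.contractionForm_toComplexAlg_baseChange_apply` (`Θ y_a` is the complex divisor `2`-vector of `a`),
  **`Polarization.span_image_toComplexAlg_divisorTwoVectors_eq`** (`span_ℂ Θ(D_ℚ) = span_ℂ D_ℂ`: the complex divisor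
  `2`-vectors are defined over `ℚ`).
* §4 THM. 3.2 OVER `ℚ`: **`Polarization.mem_span_divisorTwoVectors_pow_of_forall_lefschetzGroupBaseChange_map_toComplexAlg_eq`**
  (`x ∈ ⋀[ℚ]^{2p} V` with `Θ x` fixed by `S(H)(ℂ)` ⟹ `x ∈ (span_ℚ D_ℚ)^p`),
  `Polarization.forall_lefschetzGroupBaseChange_map_toComplexAlg_eq_of_mem_span_pow` (converse),
  **`Polarization.setOf_mem_and_forall_lefschetzGroupBaseChange_map_toComplexAlg_eq_eq_span_pow`** ("`H^{2p}(A, ℚ)^{S(A)} =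
  D^p(A)_ℚ`"), **`Polarization.setOf_forall_lefschetzGroupBaseChange_map_toComplexAlg_eq_eq_adjoin`** ("the `ℚ`-algebra
  `H*(A, ℚ)^{S(A)}` is generated by divisor classes": `{x ∈ ⋀_ℚ V | Θ x fixed by S(H)(ℂ)} = ℚ[D_ℚ]`),
  `Polarization.mem_adjoin_divisorTwoVectors_of_forall_lefschetzGroupBaseChange_map_toComplexAlg_eq`.

## Lean encoding, differences

"Fixed by the algebraic group `S(A)` over `k = ℚ`" is encoded, as on p. 652 L78–L80 with `k^{al}` replaced by the larger
algebraically closed field `ℂ`, by "`x ⊗ 1` is fixed by every `γ ∈ S(H)(ℂ)`"; `x ⊗ 1` is `toComplexAlg V x` (on `⋀ᵏ` the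
canonical `θ₀(1 ⊗ x)`). The descent (§2) is Milne's reduction "it suffices to prove the equality with `k` replaced with
`k^{al}`": `(span_ℚ D_ℚ)^p ⊗ ℂ = (span_ℂ D_ℂ)^p` inside `⋀^{2p}_ℂ V_ℂ = ℂ ⊗ ⋀^{2p}_ℚ V` and `(ℂ ⊗ N) ∩ ⋀_ℚ V = N`, proved with
a separating `ℚ`-linear functional instead of Galois descent (Serre's Lemme 26 is not needed for the inclusion used).
Odd weight throughout (alternating `Q`, as for `H¹` of an abelian variety); `r = 1` (powers `A^r`: g25-#4's diagonal action,
not repeated here).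

## References
* [Milne1999LefschetzClasses] J. S. Milne, *Lefschetz classes on abelian varieties*, Duke Math. J. 96 (1999), Lemma 3.1
  (p. 652), Thm. 3.2, Prop. 3.3, Prop. 3.4 (p. 653), §1 p. 642.
* [MumfordAV1970] D. Mumford, *Abelian varieties* (1970), §21 Application III p. 208.
* [BourbakiAlgebre1a3] N. Bourbaki, *Algèbre* Ch. III §7 no. 5 Prop. 8 (base change of the exterior algebra), §11 no. 9.
-/

open scoped TensorProduct
open DirectSum

namespace Literature.AlgebraicGeometry.Motives

/-! ### §1 `toComplexAlg` and the contraction form -/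

namespace ExteriorLefschetz

open ExteriorAlgebra

universe u

variable (V : Type u) [AddCommGroup V] [Module ℚ V]

/-- **`Θ = toComplexAlg` is compatible with the contraction form on `2`-vectors**: for `y ∈ ⋀²_ℚ V` and `ℚ`-bilinear forms
`B, B'`, `B_{Θ y}(B_ℂ(1 ⊗ v, ·), B'_ℂ(1 ⊗ w, ·)) = B_y(B(v, ·), B'(w, ·))` (check on `y = a ∧ b`, where both sides are
`B(v, b) B'(w, a) − B(v, a) B'(w, b)`). [cite: BourbakiAlgebre1a3, Ch. III §7 no. 5 Prop. 8 and §11 no. 9] -/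
theorem contractionForm_toComplexAlg_one_tmul (B B' : LinearMap.BilinForm ℚ V) {y : ExteriorAlgebra ℚ V}
    (hy : y ∈ ⋀[ℚ]^2 V) (v w : V) :
    contractionForm (toComplexAlg V y) (B.baseChange ℂ ((1 : ℂ) ⊗ₜ[ℚ] v)) (B'.baseChange ℂ ((1 : ℂ) ⊗ₜ[ℚ] w)) =
      algebraMap ℚ ℂ (contractionForm y (B v) (B' w)) := by
  have hy2 : y ∈ LinearMap.range (ι ℚ : V →ₗ[ℚ] ExteriorAlgebra ℚ V) * LinearMap.range (ι ℚ : V →ₗ[ℚ] ExteriorAlgebra ℚ V) := by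
    rw [← pow_two]
    exact hy
  refine Submodule.mul_induction_on hy2 (fun m hm m' hm' ↦ ?_) (fun x z hx hz ↦ ?_)
  · obtain ⟨a, rfl⟩ := hm
    obtain ⟨b, rfl⟩ := hm'
    rw [map_mul, toComplexAlg_ι, toComplexAlg_ι, contractionForm_ι_mul_ι, contractionForm_ι_mul_ι,
      LinearMap.BilinForm.baseChange_tmul, LinearMap.BilinForm.baseChange_tmul, LinearMap.BilinForm.baseChange_tmul,
      LinearMap.BilinForm.baseChange_tmul, mul_one, ← Algebra.algebraMap_eq_smul_one, ← Algebra.algebraMap_eq_smul_one,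
      ← Algebra.algebraMap_eq_smul_one, ← Algebra.algebraMap_eq_smul_one, ← map_mul, ← map_mul, ← map_sub]
  · rw [map_add, contractionForm_add, contractionForm_add, LinearMap.add_apply, LinearMap.add_apply, LinearMap.add_apply,
      LinearMap.add_apply, hx, hz, map_add]

/-- **The skew form of `Θ y` for `B_ℂ` is the base change of the skew form of `y` for `B`**:
`B_{Θ y}(B_ℂ(x, ·), B_ℂ(z, ·)) = (ψ_y)_ℂ(x, z)` for all `x, z ∈ ℂ ⊗ V`, `ψ_y(v, w) = B_y(B(v, ·), B(w, ·))` (both sides are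
`ℂ`-bilinear; on pure tensors this is `contractionForm_toComplexAlg_one_tmul`).
[cite: BourbakiAlgebre1a3, Ch. III §7 no. 5 Prop. 8 and §11 no. 9] -/
theorem compl₁₂_contractionForm_toComplexAlg_baseChange (B : LinearMap.BilinForm ℚ V) {y : ExteriorAlgebra ℚ V}
    (hy : y ∈ ⋀[ℚ]^2 V) :
    (contractionForm (toComplexAlg V y)).compl₁₂ (B.baseChange ℂ) (B.baseChange ℂ) =
      LinearMap.BilinForm.baseChange ℂ ((contractionForm y).compl₁₂ B B) := by
  refine LinearMap.ext fun x ↦ LinearMap.ext fun z ↦ ?_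
  rw [LinearMap.compl₁₂_apply]
  induction x using TensorProduct.induction_on with
  | zero => simp only [map_zero, LinearMap.zero_apply]
  | add x x' hx hx' => simp only [map_add, LinearMap.add_apply, hx, hx']
  | tmul c v =>
    induction z using TensorProduct.induction_on with
    | zero => simp only [map_zero]
    | add z z' hz hz' => simp only [map_add, hz, hz']
    | tmul c' w =>
      have hv : c ⊗ₜ[ℚ] v = c • ((1 : ℂ) ⊗ₜ[ℚ] v) := by rw [TensorProduct.smul_tmul', smul_eq_mul, mul_one]
      have hw : c' ⊗ₜ[ℚ] w = c' • ((1 : ℂ) ⊗ₜ[ℚ] w) := by rw [TensorProduct.smul_tmul', smul_eq_mul, mul_one]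
      rw [LinearMap.BilinForm.baseChange_tmul, LinearMap.compl₁₂_apply, hv, hw, map_smul, map_smul, map_smul,
        LinearMap.smul_apply, map_smul, contractionForm_toComplexAlg_one_tmul V B B hy v w, smul_eq_mul, smul_eq_mul,
        Algebra.smul_def]
      ring

/-! ### §2 Linear disjointness of `ℚ ⊂ ℂ` on the exterior algebra -/

/-- `span_ℂ Θ(span_ℚ S) = span_ℂ Θ(S)`. [cite: BourbakiAlgebre1a3, Ch. III §7 no. 5 Prop. 8] -/
theorem span_image_toComplexAlg_span (S : Set (ExteriorAlgebra ℚ V)) :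
    Submodule.span ℂ (toComplexAlg V '' ↑(Submodule.span ℚ S)) = Submodule.span ℂ (toComplexAlg V '' S) := by
  have h : (toComplexAlg V '' ↑(Submodule.span ℚ S) : Set (ExteriorAlgebra ℂ (ℂ ⊗[ℚ] V))) =
      ↑(Submodule.span ℚ (toComplexAlg V '' S)) := by
    rw [← AlgHom.coe_toLinearMap (toComplexAlg V), ← Submodule.map_coe, Submodule.map_span]
  rw [h, Submodule.span_span_of_tower]

/-- `span_ℂ Θ(M N) = span_ℂ Θ(M) · span_ℂ Θ(N)` (`Θ` is a ring map). [cite: BourbakiAlgebre1a3, Ch. III §7 no. 5 Prop. 8] -/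
theorem span_image_toComplexAlg_mul (M N : Submodule ℚ (ExteriorAlgebra ℚ V)) :
    Submodule.span ℂ (toComplexAlg V '' ↑(M * N)) =
      Submodule.span ℂ (toComplexAlg V '' ↑M) * Submodule.span ℂ (toComplexAlg V '' ↑N) := by
  rw [Submodule.span_mul_span, ← Set.image_mul, Submodule.mul_eq_span_mul_set M N, span_image_toComplexAlg_span]

/-- **`span_ℂ Θ(M^p) = (span_ℂ Θ(M))^p`** for a `ℚ`-submodule `M ⊆ ⋀_ℚ V`: extension of scalars commutes with products of
subspaces of the exterior algebra. [cite: BourbakiAlgebre1a3, Ch. III §7 no. 5 Prop. 8] -/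
theorem span_image_toComplexAlg_pow (M : Submodule ℚ (ExteriorAlgebra ℚ V)) :
    ∀ p : ℕ, Submodule.span ℂ (toComplexAlg V '' ↑(M ^ p)) = Submodule.span ℂ (toComplexAlg V '' ↑M) ^ p
  | 0 => by
    rw [pow_zero, pow_zero, Submodule.one_eq_span, span_image_toComplexAlg_span, Set.image_singleton, map_one,
      ← Submodule.one_eq_span]
  | p + 1 => by rw [pow_succ, pow_succ, span_image_toComplexAlg_mul, span_image_toComplexAlg_pow M p]

/-- **Linear disjointness of `ℚ ⊂ ℂ`**: for a `ℚ`-subspace `N ⊆ M₀`, if `1 ⊗ x` lies in the `ℂ`-span of `1 ⊗ N` inside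
`ℂ ⊗_ℚ M₀`, then `x ∈ N` (a `ℚ`-linear functional vanishing on `N` and not at `x` would, base-changed, vanish on that span).
[cite: Milne1999LefschetzClasses, §3 proof of Lemma 3.1 (p. 652)] -/
theorem mem_of_one_tmul_mem_span_image {M₀ : Type*} [AddCommGroup M₀] [Module ℚ M₀] (N : Submodule ℚ M₀) {x : M₀}
    (h : (1 : ℂ) ⊗ₜ[ℚ] x ∈ Submodule.span ℂ ((TensorProduct.mk ℚ ℂ M₀ 1) '' ↑N)) : x ∈ N := by
  by_contra hx
  obtain ⟨f, hfx, hfN⟩ := Submodule.exists_dual_map_eq_bot_of_notMem hx inferInstance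
  have hle : Submodule.span ℂ ((TensorProduct.mk ℚ ℂ M₀ 1) '' ↑N) ≤ LinearMap.ker (LinearMap.baseChange ℂ f) := by
    refine Submodule.span_le.2 ?_
    rintro _ ⟨m, hm, rfl⟩
    have hfm : f m = 0 := by
      have h' : f m ∈ Submodule.map f N := Submodule.mem_map_of_mem hm
      rwa [hfN, Submodule.mem_bot] at h'
    rw [SetLike.mem_coe, LinearMap.mem_ker, TensorProduct.mk_apply, LinearMap.baseChange_tmul, hfm, TensorProduct.tmul_zero]
  have h0 := hle h
  rw [LinearMap.mem_ker, LinearMap.baseChange_tmul] at h0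
  have h1 := congrArg (TensorProduct.rid ℚ ℂ) h0
  rw [TensorProduct.rid_tmul, map_zero, smul_eq_zero] at h1
  exact h1.elim hfx one_ne_zero

/-- **Descent to `ℚ` on `⋀ᵏ`**: for a `ℚ`-subspace `N ⊆ ⋀ᵏ_ℚ V` and `x ∈ ⋀ᵏ_ℚ V`, if `Θ x = x ⊗ 1` lies in the `ℂ`-span of
`Θ(N)` then `x ∈ N` — "`(ℂ ⊗ N) ∩ ⋀ᵏ_ℚ V = N`" inside `⋀ᵏ_ℂ V_ℂ ≅ ℂ ⊗ ⋀ᵏ_ℚ V` (the canonical `θ₀` is bijective, and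
`θ₀(1 ⊗ x) = Θ x`). In particular (`N = 0`) `Θ` is injective on `⋀ᵏ_ℚ V`.
[cite: Milne1999LefschetzClasses, Lemma 3.1 (p. 652)] [cite: BourbakiAlgebre1a3, Ch. III §7 no. 5 Prop. 8] -/
theorem mem_of_toComplexAlg_mem_span_image {k : ℕ} {N : Submodule ℚ (ExteriorAlgebra ℚ V)} (hN : N ≤ ⋀[ℚ]^k V)
    {x : ExteriorAlgebra ℚ V} (hx : x ∈ ⋀[ℚ]^k V)
    (h : toComplexAlg V x ∈ Submodule.span ℂ (toComplexAlg V '' ↑N)) : x ∈ N := by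
  set N' : Submodule ℚ (⋀[ℚ]^k V) := N.comap (⋀[ℚ]^k V).subtype with hN'
  set Φ : ℂ ⊗[ℚ] ⋀[ℚ]^k V →ₗ[ℂ] ExteriorAlgebra ℂ (ℂ ⊗[ℚ] V) :=
    (⋀[ℂ]^k (ℂ ⊗[ℚ] V)).subtype ∘ₗ
      (exteriorPowerBaseChangeEquiv V k : ℂ ⊗[ℚ] ⋀[ℚ]^k V →ₗ[ℂ] ⋀[ℂ]^k (ℂ ⊗[ℚ] V)) with hΦ
  have hΦinj : Function.Injective Φ :=
    (⋀[ℂ]^k (ℂ ⊗[ℚ] V)).injective_subtype.comp (exteriorPowerBaseChangeEquiv V k).injective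
  have hΦapply : ∀ z : ⋀[ℚ]^k V, Φ ((1 : ℂ) ⊗ₜ[ℚ] z) = toComplexAlg V (z : ExteriorAlgebra ℚ V) := fun z ↦ by
    rw [hΦ, LinearMap.comp_apply, LinearEquiv.coe_coe, exteriorPowerBaseChangeEquiv_apply, Submodule.subtype_apply,
      coe_exteriorPowerBaseChange_one_tmul]
  have himage : toComplexAlg V '' ↑N = Φ '' ((TensorProduct.mk ℚ ℂ (⋀[ℚ]^k V) 1) '' ↑N') := by
    ext z
    constructor
    · rintro ⟨m, hm, rfl⟩
      exact ⟨(1 : ℂ) ⊗ₜ[ℚ] (⟨m, hN hm⟩ : ⋀[ℚ]^k V), ⟨⟨m, hN hm⟩, Submodule.mem_comap.2 hm, rfl⟩, hΦapply _⟩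
    · rintro ⟨_, ⟨m', hm', rfl⟩, rfl⟩
      exact ⟨(m' : ExteriorAlgebra ℚ V), Submodule.mem_comap.1 hm', (hΦapply m').symm⟩
  rw [himage, Submodule.span_image, show toComplexAlg V x = Φ ((1 : ℂ) ⊗ₜ[ℚ] (⟨x, hx⟩ : ⋀[ℚ]^k V)) from (hΦapply ⟨x, hx⟩).symm,
    Submodule.mem_map] at h
  obtain ⟨z, hz, hzx⟩ := h
  rw [hΦinj hzx] at hz
  exact Submodule.mem_comap.1 (mem_of_one_tmul_mem_span_image N' hz)

/-- **`Θ` respects the grading**: the degree-`i` component of `Θ x` is `Θ` of the degree-`i` component of `x`.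
[cite: BourbakiAlgebre1a3, Ch. III §7 no. 5 Prop. 8] -/
theorem coe_decompose_toComplexAlg (x : ExteriorAlgebra ℚ V) (i : ℕ) :
    ((decompose (fun i : ℕ => ⋀[ℂ]^i (ℂ ⊗[ℚ] V)) (toComplexAlg V x) i : ⋀[ℂ]^i (ℂ ⊗[ℚ] V)) :
        ExteriorAlgebra ℂ (ℂ ⊗[ℚ] V)) =
      toComplexAlg V ((decompose (fun i : ℕ => ⋀[ℚ]^i V) x i : ⋀[ℚ]^i V) : ExteriorAlgebra ℚ V) := by
  induction x using DirectSum.Decomposition.inductionOn (fun i : ℕ => ⋀[ℚ]^i V) with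
  | zero =>
    rw [map_zero, decompose_zero (fun i : ℕ => ⋀[ℂ]^i (ℂ ⊗[ℚ] V)), decompose_zero (fun i : ℕ => ⋀[ℚ]^i V),
      DirectSum.zero_apply, DirectSum.zero_apply, ZeroMemClass.coe_zero, ZeroMemClass.coe_zero, map_zero]
  | @homogeneous j y =>
    have hy' : toComplexAlg V (y : ExteriorAlgebra ℚ V) ∈ ⋀[ℂ]^j (ℂ ⊗[ℚ] V) := toComplexAlg_mem V y.2
    by_cases hij : j = i
    · subst hij
      rw [decompose_of_mem_same (fun i : ℕ => ⋀[ℂ]^i (ℂ ⊗[ℚ] V)) hy', decompose_of_mem_same (fun i : ℕ => ⋀[ℚ]^i V) y.2]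
    · rw [decompose_of_mem_ne (fun i : ℕ => ⋀[ℂ]^i (ℂ ⊗[ℚ] V)) hy' hij,
        decompose_of_mem_ne (fun i : ℕ => ⋀[ℚ]^i V) y.2 hij, map_zero]
  | add y z hy hz =>
    rw [map_add, decompose_add (fun i : ℕ => ⋀[ℂ]^i (ℂ ⊗[ℚ] V)), DirectSum.add_apply, Submodule.coe_add, hy, hz,
      decompose_add (fun i : ℕ => ⋀[ℚ]^i V), DirectSum.add_apply, Submodule.coe_add, map_add]

end ExteriorLefschetz

/-! ### §3 Rational divisor `2`-vectors -/

namespace HodgeStructure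

open ExteriorLefschetz ExteriorAlgebra

universe u

variable {V : Type u} [AddCommGroup V] [Module ℚ V] [Module.Finite ℚ V] {n : ℤ} {H : HodgeStructure V n}
  (Q : Polarization H)

/-- **`Q(a ·, ·)` is alternating for `†`-symmetric `a`** (odd weight): `Q(a x, x) = Q(x, a† x) = Q(x, a x) = −Q(a x, x)`.
[cite: Milne1999LefschetzClasses, §1 p. 642 L68–L74] [cite: MumfordAV1970, §21 Application III p. 208] -/
theorem Polarization.form_comp_isAlt_of_adjoint_eq (hn : Odd n) {a : Module.End ℚ V} (ha' : Q.adjoint a = a) :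
    (Q.form ∘ₗ a).IsAlt := by
  intro x
  rw [LinearMap.comp_apply]
  have h1 : Q.form (a x) x = Q.form x (a x) := by rw [← Q.form_apply_adjoint a x x, ha']
  have h : Q.form x (a x) = ((n.negOnePow : ℤˣ) : ℤ) • Q.form (a x) x := LinearMap.congr_fun₂ Q.flip_form (a x) x
  rw [Int.negOnePow_odd n hn, Units.val_neg, Units.val_one, neg_smul, one_smul] at h
  have h2 : (2 : ℚ) * Q.form (a x) x = 0 := by rw [two_mul]; nth_rewrite 1 [h1, h]; exact neg_add_cancel _
  exact (mul_eq_zero.1 h2).resolve_left two_ne_zero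

/-- **The rational divisor `2`-vectors exist and are unique**: for odd weight and `a ∈ End_ℚ V` with `a† = a` there is
exactly one `y_a ∈ ⋀[ℚ]^2 V` whose skew form `ψ_{y_a}(v, w) = B_{y_a}(Q(v, ·), Q(w, ·))` is `Q(a v, w)` — the divisor class
`e_D = Q(a ·, ·)` read on `⋀² V` through `V ≅ V^∨`, with RATIONAL coefficients.
[cite: Milne1999LefschetzClasses, §1 p. 642 L68–L74 and Prop. 3.3 (p. 653)] [cite: MumfordAV1970, §21 Application III p. 208] -/
theorem Polarization.exists_mem_exteriorPower_two_rat_forall_contractionForm_apply_eq (hn : Odd n) {a : Module.End ℚ V}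
    (ha' : Q.adjoint a = a) :
    ∃ y ∈ ⋀[ℚ]^2 V, (∀ v w, contractionForm y (Q.form v) (Q.form w) = Q.form (a v) w) ∧
      ∀ y' ∈ ⋀[ℚ]^2 V, (∀ v w, contractionForm y' (Q.form v) (Q.form w) = Q.form (a v) w) → y' = y := by
  obtain ⟨y, hy, hyψ⟩ := ExteriorLefschetz.exists_mem_exteriorPower_two_forall_contractionForm_apply_eq Q.nondegenerate
    (Q.form_isAlt_of_odd hn) (Q.form ∘ₗ a) (Q.form_comp_isAlt_of_adjoint_eq hn ha')
  exact ⟨y, hy, fun v w ↦ by rw [hyψ, LinearMap.comp_apply], fun y' hy' hy'ψ ↦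
    eq_of_forall_contractionForm_apply_eq Q.nondegenerate hy' hy fun v w ↦ by rw [hyψ, hy'ψ, LinearMap.comp_apply]⟩

omit [Module.Finite ℚ V] in
/-- **`Θ y_a` is the COMPLEX divisor `2`-vector of `a`**: if `ψ_y = Q(a ·, ·)` over `ℚ` then `ψ_{Θ y} = (Q(a ·, ·))_ℂ` on all of
`ℂ ⊗ V`. [cite: Milne1999LefschetzClasses, Lemma 3.1 (p. 652) and Prop. 3.3 (p. 653)] -/
theorem Polarization.contractionForm_toComplexAlg_baseChange_apply {a : Module.End ℚ V} {y : ExteriorAlgebra ℚ V}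
    (hy : y ∈ ⋀[ℚ]^2 V) (hyψ : ∀ v w, contractionForm y (Q.form v) (Q.form w) = Q.form (a v) w) (x z : ℂ ⊗[ℚ] V) :
    contractionForm (toComplexAlg V y) (Q.form.baseChange ℂ x) (Q.form.baseChange ℂ z) =
      LinearMap.BilinForm.baseChange ℂ (Q.form ∘ₗ a) x z := by
  have h := LinearMap.congr_fun₂ (compl₁₂_contractionForm_toComplexAlg_baseChange V Q.form hy) x z
  rw [LinearMap.compl₁₂_apply] at h
  have heq : (contractionForm y).compl₁₂ Q.form Q.form = Q.form ∘ₗ a :=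
    LinearMap.ext fun v ↦ LinearMap.ext fun w ↦ by rw [LinearMap.compl₁₂_apply, hyψ, LinearMap.comp_apply]
  rw [h, heq]

/-- `Θ` maps rational divisor `2`-vectors to complex divisor `2`-vectors (same `a`).
[cite: Milne1999LefschetzClasses, Lemma 3.1 (p. 652) and Prop. 3.3 (p. 653)] -/
theorem Polarization.toComplexAlg_mem_divisorTwoVectors {y : ExteriorAlgebra ℚ V}
    (hy : y ∈ {y : ExteriorAlgebra ℚ V | y ∈ ⋀[ℚ]^2 V ∧ ∃ a ∈ H.endAlg, Q.adjoint a = a ∧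
      ∀ v w, contractionForm y (Q.form v) (Q.form w) = Q.form (a v) w}) :
    toComplexAlg V y ∈ {y' : ExteriorAlgebra ℂ (ℂ ⊗[ℚ] V) | y' ∈ ⋀[ℂ]^2 (ℂ ⊗[ℚ] V) ∧ ∃ a ∈ H.endAlg, Q.adjoint a = a ∧
      ∀ v w, contractionForm y' (Q.form.baseChange ℂ v) (Q.form.baseChange ℂ w) =
        LinearMap.BilinForm.baseChange ℂ (Q.form ∘ₗ a) v w} := by
  obtain ⟨hy2, a, ha, ha', hyψ⟩ := hy
  exact ⟨toComplexAlg_mem V hy2, a, ha, ha', Q.contractionForm_toComplexAlg_baseChange_apply hy2 hyψ⟩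

/-- **The complex divisor `2`-vectors are defined over `ℚ`**: `span_ℂ Θ(D_ℚ) = span_ℂ D_ℂ` — every complex divisor
`2`-vector `y_a` (`a ∈ E_φ`, `a† = a`) is `Θ` of the rational one (uniqueness of `y_a` over `ℂ`, g25-#3).
[cite: Milne1999LefschetzClasses, Lemma 3.1 (p. 652) and Prop. 3.3 (p. 653)] [cite: MumfordAV1970, §21 Application III p. 208] -/
theorem Polarization.span_image_toComplexAlg_divisorTwoVectors_eq (hn : Odd n) :
    Submodule.span ℂ (toComplexAlg V '' {y : ExteriorAlgebra ℚ V | y ∈ ⋀[ℚ]^2 V ∧ ∃ a ∈ H.endAlg, Q.adjoint a = a ∧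
        ∀ v w, contractionForm y (Q.form v) (Q.form w) = Q.form (a v) w}) =
      Submodule.span ℂ {y' : ExteriorAlgebra ℂ (ℂ ⊗[ℚ] V) | y' ∈ ⋀[ℂ]^2 (ℂ ⊗[ℚ] V) ∧ ∃ a ∈ H.endAlg, Q.adjoint a = a ∧
        ∀ v w, contractionForm y' (Q.form.baseChange ℂ v) (Q.form.baseChange ℂ w) =
          LinearMap.BilinForm.baseChange ℂ (Q.form ∘ₗ a) v w} := by
  refine le_antisymm (Submodule.span_mono ?_) (Submodule.span_le.2 fun y' hy' ↦ ?_)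
  · rintro _ ⟨y, hy, rfl⟩
    exact Q.toComplexAlg_mem_divisorTwoVectors hy
  · obtain ⟨hy'2, a, ha, ha', hy'ψ⟩ := hy'
    obtain ⟨yq, hyq, hyqψ, -⟩ := Q.exists_mem_exteriorPower_two_rat_forall_contractionForm_apply_eq hn ha'
    obtain ⟨ya, -, -, -, huniq⟩ := Q.exists_mem_exteriorPower_two_forall_contractionForm_apply_eq_baseChange ℂ hn ha ha'
    have he : y' = toComplexAlg V yq := by
      rw [huniq y' hy'2 hy'ψ, huniq (toComplexAlg V yq) (toComplexAlg_mem V hyq)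
        (Q.contractionForm_toComplexAlg_baseChange_apply hyq hyqψ)]
    rw [he]
    exact Submodule.subset_span ⟨yq, ⟨hyq, a, ha, ha', hyqψ⟩, rfl⟩

/-! ### §4 Milne 1999, Thm. 3.2 with rational coefficients -/

/-- **Rational Lefschetz classes are `S(H)`-invariant**: for `x ∈ (span_ℚ D_ℚ)^p`, `Θ x = x ⊗ 1` is fixed by every
`γ ∈ S(H)(ℂ)` (`Θ x ∈ (span_ℂ D_ℂ)^p`, and complex divisor `2`-vectors are `S(H)(ℂ)`-invariant, g25-#3/#5).
[cite: Milne1999LefschetzClasses, Thm. 3.2 and Prop. 3.3 (p. 653)] -/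
theorem Polarization.forall_lefschetzGroupBaseChange_map_toComplexAlg_eq_of_mem_span_pow (hn : Odd n) (p : ℕ)
    {x : ExteriorAlgebra ℚ V}
    (hx : x ∈ Submodule.span ℚ {y : ExteriorAlgebra ℚ V | y ∈ ⋀[ℚ]^2 V ∧ ∃ a ∈ H.endAlg, Q.adjoint a = a ∧
      ∀ v w, contractionForm y (Q.form v) (Q.form w) = Q.form (a v) w} ^ p) :
    ∀ γ ∈ Q.lefschetzGroupBaseChange ℂ,
      ExteriorAlgebra.map (γ : (ℂ ⊗[ℚ] V) →ₗ[ℂ] (ℂ ⊗[ℚ] V)) (toComplexAlg V x) = toComplexAlg V x := by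
  intro γ hγ
  have hmem : toComplexAlg V x ∈ Submodule.span ℂ {y' : ExteriorAlgebra ℂ (ℂ ⊗[ℚ] V) | y' ∈ ⋀[ℂ]^2 (ℂ ⊗[ℚ] V) ∧
      ∃ a ∈ H.endAlg, Q.adjoint a = a ∧ ∀ v w, contractionForm y' (Q.form.baseChange ℂ v) (Q.form.baseChange ℂ w) =
        LinearMap.BilinForm.baseChange ℂ (Q.form ∘ₗ a) v w} ^ p := by
    rw [← Q.span_image_toComplexAlg_divisorTwoVectors_eq hn, ← span_image_toComplexAlg_span, ← span_image_toComplexAlg_pow]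
    exact Submodule.subset_span ⟨x, hx, rfl⟩
  refine map_eq_of_mem_span_pow (γ : (ℂ ⊗[ℚ] V) →ₗ[ℂ] (ℂ ⊗[ℚ] V)) (fun y' hy' ↦ ?_) p _ hmem
  obtain ⟨hy'2, a, ha, ha', hy'ψ⟩ := hy'
  obtain ⟨ya, -, -, hinv, huniq⟩ := Q.exists_mem_exteriorPower_two_forall_contractionForm_apply_eq_baseChange ℂ hn ha ha'
  rw [huniq y' hy'2 hy'ψ]
  exact hinv γ hγ

/-- **Milne 1999, Thm. 3.2 DEGREEWISE with rational coefficients** (Lemma 3.1 + Prop. 3.3/3.4): for a polarized `ℚ`-Hodge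
structure of odd weight, a RATIONAL class `x ∈ ⋀[ℚ]^{2p} V` whose complexification `Θ x = x ⊗ 1` is fixed by every
`γ ∈ S(H)(ℂ)` is a `ℚ`-linear combination of `p`-fold products of rational divisor `2`-vectors: `x ∈ (span_ℚ D_ℚ)^p`
("`H^{2p}(A, ℚ)^{S(A)} ⊆ D^p(A)_ℚ`"). [cite: Milne1999LefschetzClasses, Lemma 3.1 (p. 652), Thm. 3.2, Prop. 3.3, Prop. 3.4 (p. 653)]
[cite: MumfordAV1970, §21 Application III p. 208] -/
theorem Polarization.mem_span_divisorTwoVectors_pow_of_forall_lefschetzGroupBaseChange_map_toComplexAlg_eq (hn : Odd n)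
    {p : ℕ} {x : ExteriorAlgebra ℚ V} (hxm : x ∈ ⋀[ℚ]^(2 * p) V)
    (hx : ∀ γ ∈ Q.lefschetzGroupBaseChange ℂ,
      ExteriorAlgebra.map (γ : (ℂ ⊗[ℚ] V) →ₗ[ℂ] (ℂ ⊗[ℚ] V)) (toComplexAlg V x) = toComplexAlg V x) :
    x ∈ Submodule.span ℚ {y : ExteriorAlgebra ℚ V | y ∈ ⋀[ℚ]^2 V ∧ ∃ a ∈ H.endAlg, Q.adjoint a = a ∧
      ∀ v w, contractionForm y (Q.form v) (Q.form w) = Q.form (a v) w} ^ p := by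
  have h := Q.mem_span_divisorTwoVectors_pow_of_forall_lefschetzGroupBaseChange_map_eq ℂ hn (toComplexAlg_mem V hxm) hx
  rw [← Q.span_image_toComplexAlg_divisorTwoVectors_eq hn, ← span_image_toComplexAlg_span,
    ← span_image_toComplexAlg_pow] at h
  exact mem_of_toComplexAlg_mem_span_image V (span_pow_le_exteriorPower (fun y hy ↦ hy.1) p) hxm h

/-- **"`H^{2p}(A, ℚ)^{S(A)} = D^p(A)_ℚ`" as sets**: the rational `2p`-vectors whose complexification is `S(H)(ℂ)`-invariant
are exactly `(span_ℚ D_ℚ)^p`. [cite: Milne1999LefschetzClasses, Lemma 3.1 (p. 652), Thm. 3.2 (p. 653); §4 Cor. 4.5 (p. 659)] -/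
theorem Polarization.setOf_mem_and_forall_lefschetzGroupBaseChange_map_toComplexAlg_eq_eq_span_pow (hn : Odd n) (p : ℕ) :
    {x : ExteriorAlgebra ℚ V | x ∈ ⋀[ℚ]^(2 * p) V ∧ ∀ γ ∈ Q.lefschetzGroupBaseChange ℂ,
        ExteriorAlgebra.map (γ : (ℂ ⊗[ℚ] V) →ₗ[ℂ] (ℂ ⊗[ℚ] V)) (toComplexAlg V x) = toComplexAlg V x} =
      ↑(Submodule.span ℚ {y : ExteriorAlgebra ℚ V | y ∈ ⋀[ℚ]^2 V ∧ ∃ a ∈ H.endAlg, Q.adjoint a = a ∧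
        ∀ v w, contractionForm y (Q.form v) (Q.form w) = Q.form (a v) w} ^ p) := by
  refine Set.Subset.antisymm
    (fun x hx ↦ Q.mem_span_divisorTwoVectors_pow_of_forall_lefschetzGroupBaseChange_map_toComplexAlg_eq hn hx.1 hx.2)
    fun x hx ↦ ⟨span_pow_le_exteriorPower (fun y hy ↦ hy.1) p hx,
      Q.forall_lefschetzGroupBaseChange_map_toComplexAlg_eq_of_mem_span_pow hn p hx⟩

/-- **Milne 1999, Thm. 3.2 with rational coefficients, whole algebra**: EVERY rational class `x ∈ ⋀_ℚ V` (homogeneous or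
not) whose complexification is fixed by `S(H)(ℂ)` lies in the `ℚ`-subalgebra `ℚ[D_ℚ]` generated by the rational divisor
`2`-vectors (each homogeneous component of `x` is invariant since `Θ` and `⋀(γ)` respect the grading; odd components vanish
over `ℂ`, hence over `ℚ` by injectivity of `Θ`; even ones by the degreewise theorem).
[cite: Milne1999LefschetzClasses, Lemma 3.1 (p. 652), Thm. 3.2, Prop. 3.4 (p. 653)] -/
theorem Polarization.mem_adjoin_divisorTwoVectors_of_forall_lefschetzGroupBaseChange_map_toComplexAlg_eq (hn : Odd n)
    {x : ExteriorAlgebra ℚ V}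
    (hx : ∀ γ ∈ Q.lefschetzGroupBaseChange ℂ,
      ExteriorAlgebra.map (γ : (ℂ ⊗[ℚ] V) →ₗ[ℂ] (ℂ ⊗[ℚ] V)) (toComplexAlg V x) = toComplexAlg V x) :
    x ∈ Algebra.adjoin ℚ {y : ExteriorAlgebra ℚ V | y ∈ ⋀[ℚ]^2 V ∧ ∃ a ∈ H.endAlg, Q.adjoint a = a ∧
      ∀ v w, contractionForm y (Q.form v) (Q.form w) = Q.form (a v) w} := by
  classical
  rw [← sum_support_decompose (fun i : ℕ => ⋀[ℚ]^i V) x]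
  refine Subalgebra.sum_mem _ fun i _ ↦ ?_
  have hxi : ∀ γ ∈ Q.lefschetzGroupBaseChange ℂ, ExteriorAlgebra.map (γ : (ℂ ⊗[ℚ] V) →ₗ[ℂ] (ℂ ⊗[ℚ] V))
      (toComplexAlg V ((decompose (fun i : ℕ => ⋀[ℚ]^i V) x i : ⋀[ℚ]^i V) : ExteriorAlgebra ℚ V)) =
        toComplexAlg V ((decompose (fun i : ℕ => ⋀[ℚ]^i V) x i : ⋀[ℚ]^i V) : ExteriorAlgebra ℚ V) := fun γ hγ ↦ by
    rw [← coe_decompose_toComplexAlg]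
    exact Milne1999.map_decompose_eq_of_map_eq (γ : (ℂ ⊗[ℚ] V) →ₗ[ℂ] (ℂ ⊗[ℚ] V)) (hx γ hγ) i
  obtain ⟨p, rfl | rfl⟩ := Nat.even_or_odd' i
  · have hmem := Q.mem_span_divisorTwoVectors_pow_of_forall_lefschetzGroupBaseChange_map_toComplexAlg_eq hn
      (decompose (fun i : ℕ => ⋀[ℚ]^i V) x (2 * p)).2 hxi
    exact Submodule.pow_induction_on_left _ (C := fun z ↦ z ∈ Algebra.adjoin ℚ {y : ExteriorAlgebra ℚ V | y ∈ ⋀[ℚ]^2 V ∧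
        ∃ a ∈ H.endAlg, Q.adjoint a = a ∧ ∀ v w, contractionForm y (Q.form v) (Q.form w) = Q.form (a v) w})
      (fun r ↦ Subalgebra.algebraMap_mem _ r) (fun _ _ hy hz ↦ Subalgebra.add_mem _ hy hz)
      (fun m hm _ hz ↦ Subalgebra.mul_mem _ (Algebra.span_le_adjoin ℚ _ hm) hz) hmem
  · have h0 : toComplexAlg V ((decompose (fun i : ℕ => ⋀[ℚ]^i V) x (2 * p + 1) : ⋀[ℚ]^(2 * p + 1) V) :
        ExteriorAlgebra ℚ V) = 0 :=
      Q.eq_zero_of_forall_lefschetzGroupBaseChange_map_eq_of_odd ℂ ⟨p, rfl⟩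
        (toComplexAlg_mem V (decompose (fun i : ℕ => ⋀[ℚ]^i V) x (2 * p + 1)).2) hxi
    have hbot : ((decompose (fun i : ℕ => ⋀[ℚ]^i V) x (2 * p + 1) : ⋀[ℚ]^(2 * p + 1) V) : ExteriorAlgebra ℚ V) ∈
        (⊥ : Submodule ℚ (ExteriorAlgebra ℚ V)) :=
      mem_of_toComplexAlg_mem_span_image V bot_le (decompose (fun i : ℕ => ⋀[ℚ]^i V) x (2 * p + 1)).2
        (by rw [h0]; exact Submodule.zero_mem _)
    rw [(Submodule.mem_bot ℚ).1 hbot]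
    exact Subalgebra.zero_mem _

/-- **"The `ℚ`-algebra `H*(A, ℚ)^{S(A)}` is generated by divisor classes" as sets**: the rational classes whose
complexification is `S(H)(ℂ)`-invariant form exactly the `ℚ`-subalgebra `ℚ[D_ℚ]` (the reverse inclusion: `Θ` and `⋀(γ)` are
algebra maps and rational divisor `2`-vectors are invariant). [cite: Milne1999LefschetzClasses, Lemma 3.1 (p. 652), Thm. 3.2 (p. 653)]
[cite: MumfordAV1970, §21 Application III p. 208] -/
theorem Polarization.setOf_forall_lefschetzGroupBaseChange_map_toComplexAlg_eq_eq_adjoin (hn : Odd n) :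
    {x : ExteriorAlgebra ℚ V | ∀ γ ∈ Q.lefschetzGroupBaseChange ℂ,
        ExteriorAlgebra.map (γ : (ℂ ⊗[ℚ] V) →ₗ[ℂ] (ℂ ⊗[ℚ] V)) (toComplexAlg V x) = toComplexAlg V x} =
      ↑(Algebra.adjoin ℚ {y : ExteriorAlgebra ℚ V | y ∈ ⋀[ℚ]^2 V ∧ ∃ a ∈ H.endAlg, Q.adjoint a = a ∧
        ∀ v w, contractionForm y (Q.form v) (Q.form w) = Q.form (a v) w}) := by
  refine Set.Subset.antisymm
    (fun x hx ↦ Q.mem_adjoin_divisorTwoVectors_of_forall_lefschetzGroupBaseChange_map_toComplexAlg_eq hn hx)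
    fun x hx γ hγ ↦ ?_
  refine Algebra.adjoin_induction (fun y hy ↦ ?_) (fun r ↦ ?_) (fun y z _ _ hy hz ↦ by rw [map_add, map_add, hy, hz])
    (fun y z _ _ hy hz ↦ by rw [map_mul, map_mul, hy, hz]) hx
  · have hy1 : y ∈ Submodule.span ℚ {y : ExteriorAlgebra ℚ V | y ∈ ⋀[ℚ]^2 V ∧ ∃ a ∈ H.endAlg, Q.adjoint a = a ∧
        ∀ v w, contractionForm y (Q.form v) (Q.form w) = Q.form (a v) w} ^ 1 := by
      rw [pow_one]
      exact Submodule.subset_span hy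
    exact Q.forall_lefschetzGroupBaseChange_map_toComplexAlg_eq_of_mem_span_pow hn 1 hy1 γ hγ
  · rw [AlgHom.commutes, IsScalarTower.algebraMap_apply ℚ ℂ (ExteriorAlgebra ℂ (ℂ ⊗[ℚ] V)) r, AlgHom.commutes]

end HodgeStructure

end Literature.AlgebraicGeometry.Motives
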